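import Literature.MathematicalPhysics.QuantumLattice.GrassmannReflectionPositivity
import HarnessLib

/-!
# Block projections of a Grassmann algebra and their intertwining with a reflection

Companion of `GrassmannReflectionPositivity.lean`.  For a block `P` of generators of
`Λ = ⋀_ℂ ℂ^ι`, `blockProj P` is the coordinate projection onto the span of the monomials `θ_s`,
`s ⊆ P` — the subalgebra `Λ_P` generated by the `θ_p`, `p ∈ P` (= `spectatorSubalgebra Pᶜ`).  In the
reflection-positivity argument for lattice fermions (Osterwalder–Seiler 1978 §3; Montvay–Münster
§4.2.3 (4.93)/(4.100): `S = S₊ + S₋ + S_c`) the action is split into its positive-time part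
`S₊ = blockProj P S`, its negative-time part `blockProj Pᶜ S` and the crossing remainder; if the
reflection `Θ` permutes the generators, `θ_w ↦ ε_w θ_{σ w}` with `σ(P) = Pᶜ`, then
`Θ ∘ blockProj P = blockProj Pᶜ ∘ Θ` (`map_blockProj`), so that reflection symmetry of the whole
action `Θ S(Θ'U) = S(U)` gives `Θ S₊(Θ'U) = S₋(U)` for free.

* `blockProj P` (a linear endomorphism), `blockProj_grassmannBasis`, `blockProj_mem_spectator`,
  `blockProj_gen_mul_gen` (`π_P (θ_v θ_w) = [v ∈ P ∧ w ∈ P] θ_v θ_w`);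
* `map_blockProj` — the intertwining with a generator-permuting antilinear reflection.

Everything is proved; no named fact.

## Sources

K. Osterwalder, E. Seiler, Ann. Phys. 110 (1978) 440, §3; I. Montvay, G. Münster, *Quantum Fields on a
Lattice* (CUP 1994), §4.2.3 (4.93), (4.100).
-/

noncomputable section

open scoped ComplexConjugate

namespace Literature.MathematicalPhysics.QuantumLattice

namespace GrassmannAlgebra

open ExteriorAlgebra

variable {ι : Type*} [LinearOrder ι] [Fintype ι]

/-- **The block projection** onto the span of the monomials supported in `P`:
`θ_s ↦ θ_s` if `s ⊆ P`, `θ_s ↦ 0` otherwise. [cite: MontvayMunster1994, §4.2.3 (4.93) and (4.100)] -/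
def blockProj (P : Finset ι) : GrassmannAlgebra ℂ ι →ₗ[ℂ] GrassmannAlgebra ℂ ι :=
  (grassmannBasis ℂ ι).constr ℂ fun s => if s ⊆ P then grassmannBasis ℂ ι s else 0

/-- The block projection on a monomial. [folklore] -/
@[simp] theorem blockProj_grassmannBasis (P s : Finset ι) :
    blockProj P (grassmannBasis ℂ ι s) = if s ⊆ P then grassmannBasis ℂ ι s else 0 := by
  rw [blockProj, Module.Basis.constr_basis]

/-- The block projection expanded over coordinates. [folklore] -/
theorem blockProj_eq_sum (P : Finset ι) (y : GrassmannAlgebra ℂ ι) :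
    blockProj P y = ∑ s, (if s ⊆ P then (grassmannBasis ℂ ι).repr y s else 0) • grassmannBasis ℂ ι s := by
  conv_lhs => rw [← (grassmannBasis ℂ ι).sum_repr y]
  rw [map_sum]
  refine Finset.sum_congr rfl fun s _ => ?_
  rw [map_smul, blockProj_grassmannBasis]
  split_ifs <;> simp

/-- The block projection lands in `Λ_P` (the spectators of `Pᶜ`). [folklore] -/
theorem blockProj_mem_spectator (P : Finset ι) (y : GrassmannAlgebra ℂ ι) :
    blockProj P y ∈ spectatorSubalgebra ℂ Pᶜ := by
  rw [blockProj_eq_sum]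
  refine Subalgebra.sum_mem _ fun s _ => ?_
  by_cases hs : s ⊆ P
  · exact Subalgebra.smul_mem _ (grassmannBasis_mem_spectatorSubalgebra ℂ
      (Finset.disjoint_of_subset_left hs disjoint_compl_right)) _
  · rw [if_neg hs, zero_smul]
    exact Subalgebra.zero_mem _

/-- **The block projection of a product of two generators**: `π_P (θ_v θ_w) = θ_v θ_w` if
`v, w ∈ P`, and `0` otherwise. [folklore] -/
theorem blockProj_gen_mul_gen (P : Finset ι) (v w : ι) :
    blockProj P (gen ℂ v * gen ℂ w) = if v ∈ P ∧ w ∈ P then gen ℂ v * gen ℂ w else 0 := by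
  classical
  by_cases hvw : v = w
  · subst hvw
    simp [gen_mul_self]
  rw [← grassmannBasis_singleton ℂ w, gen_mul_grassmannBasis_of_not_mem ℂ (by simpa using hvw),
    map_smul, blockProj_grassmannBasis]
  have hsub : insert v ({w} : Finset ι) ⊆ P ↔ v ∈ P ∧ w ∈ P := by simp [Finset.insert_subset_iff]
  by_cases h : v ∈ P ∧ w ∈ P
  · rw [if_pos (hsub.2 h), if_pos h]
  · rw [if_neg (fun h' => h (hsub.1 h')), if_neg h, smul_zero]

variable (Θ : Reflection ι) {P : Finset ι} {σ : ι → ι} {ε : ι → ℂ}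

/-- If `σ` exchanges `P` and its complement, a finset lies in `P` iff its image avoids `P`. [folklore] -/
theorem image_subset_compl_iff (hσ : ∀ w, w ∈ P ↔ σ w ∉ P) (s : Finset ι) :
    s.image σ ⊆ Pᶜ ↔ s ⊆ P := by
  constructor
  · intro h w hw
    exact (hσ w).2 (Finset.mem_compl.1 (h (Finset.mem_image_of_mem σ hw)))
  · intro h x hx
    obtain ⟨w, hw, rfl⟩ := Finset.mem_image.1 hx
    exact Finset.mem_compl.2 ((hσ w).1 (h hw))

/-- **A generator-permuting reflection intertwines the block projections of `P` and `Pᶜ`**: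
if `Θ θ_w = ε_w θ_{σ w}` for all generators, `σ` injective and `w ∈ P ↔ σ w ∉ P`, then
`Θ (π_P y) = π_{Pᶜ} (Θ y)`.  Hence reflection symmetry of a whole action, `Θ S(Θ'U) = S(U)`, yields
`Θ S₊(Θ'U) = S₋(U)` for its blocks (Montvay–Münster (4.95)/(4.106)). [cite: MontvayMunster1994, §4.2.3 (4.95) and (4.106)] -/
theorem map_blockProj (hΘ : ∀ w, Θ (gen ℂ w) = ε w • gen ℂ (σ w)) (hinj : Function.Injective σ)
    (hσ : ∀ w, w ∈ P ↔ σ w ∉ P) (y : GrassmannAlgebra ℂ ι) :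
    Θ (blockProj P y) = blockProj Pᶜ (Θ y) := by
  classical
  have hbasis : ∀ s : Finset ι, Θ (blockProj P (grassmannBasis ℂ ι s)) =
      blockProj Pᶜ (Θ (grassmannBasis ℂ ι s)) := by
    intro s
    obtain ⟨c, hc⟩ := exists_map_grassmannBasis_eq_smul Θ (P := Finset.univ) (fun w _ => hΘ w)
      (hinj.injOn.mono (Set.subset_univ _)) (Finset.subset_univ s)
    rw [blockProj_grassmannBasis, hc, map_smul, blockProj_grassmannBasis]
    by_cases h : s ⊆ P
    · rw [if_pos h, if_pos ((image_subset_compl_iff hσ s).2 h), hc]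
    · rw [if_neg h, if_neg (fun h' => h ((image_subset_compl_iff hσ s).1 h')), Θ.map_zero, smul_zero]
  conv_lhs => rw [← (grassmannBasis ℂ ι).sum_repr y, map_sum, Θ.map_sum]
  conv_rhs => rw [← (grassmannBasis ℂ ι).sum_repr y, Θ.map_sum, map_sum]
  refine Finset.sum_congr rfl fun s _ => ?_
  rw [map_smul, Θ.map_smul, Θ.map_smul, map_smul, hbasis]

end GrassmannAlgebra

end Literature.MathematicalPhysics.QuantumLattice
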